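import Literature.Probability.Percolation.AnnulusOrderTransfer
import HarnessLib

/-!
# Four alternating arms meet the inner circle in the order of their outer landing sides

Topic `Literature/Probability/Percolation`; family `crit-perc`. The order certificate needed at
the INTERNAL extremities in the proof of the near-critical arm-separation theorem for four arms
of alternating colours (P. Nolin, *Near-critical percolation in two dimensions*, EJP 13 (2008),
Thm. 11, `j = 4`, `σ = BWBW` [arXiv 0711.4948: Thm. 10], §4.4 "internal extremities"): four arms
of the annulus `{m ≤ |v| ≤ N'}` — open, closed, open, closed — whose outer ends lie in the
perimeter blocks of the sides `0, 2, 3, 5` of `∂Λ_{N'}` have their inner ends on `∂Λ_m` in the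
same anticlockwise cyclic order (`fourArm_chain`). Ingredients: the order transfer across a slit
annulus (`IsSlit.hexShift_lt_iff`, with the slits cut out of the two open arms,
`exists_isSlit`), and the non-existence of a path joining the two open (closed) arms, against the
closed (open) path formed by the two other arms and the hole (`not_joined_through_hole`, from
`triBall_not_interleaved_shift`).

Everything here is proved; no named facts are introduced.

## References

* P. Nolin, Near-critical percolation in two dimensions, EJP 13 (2008), §4.4 (arXiv 0711.4948: proof of Thm. 10, internal extremities) [Nolin2008].
* B. Bollobás, O. Riordan, *Percolation*, CUP (2006), Ch. 7 Lemma 5 p. 169 [BollobasRiordan2006].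
-/

noncomputable section

open Finset

namespace Literature.Probability.Percolation

open LatticeModels

/-! ### Rotating a chain of shifted coordinates -/

/-- From `p < q < r` anticlockwise from `b`: `q < r` anticlockwise from `p`. [folklore] -/
theorem hexShift_rotate₁ {K : ℕ} (hK : 1 ≤ K) {b p q r : Site 2} (hb : triNorm b = K) (hp : triNorm p = K)
    (hq : triNorm q = K) (hr : triNorm r = K) (h₁ : hexShift K b p < hexShift K b q) (h₂ : hexShift K b q < hexShift K b r) :
    hexShift K p q < hexShift K p r := by
  have r1 := hexShift_range hK hb hp
  have r2 := hexShift_range hK hb hq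
  have r3 := hexShift_range hK hb hr
  have r4 := hexShift_range hK hp hq
  have r5 := hexShift_range hK hp hr
  rcases hexShift_rebase hK hb hp hq with e | e <;> rcases hexShift_rebase hK hb hp hr with e' | e' <;> omega

/-- From `p < q < r` anticlockwise from `b`: `p < q` anticlockwise from `r`. [folklore] -/
theorem hexShift_rotate₃ {K : ℕ} (hK : 1 ≤ K) {b p q r : Site 2} (hb : triNorm b = K) (hp : triNorm p = K)
    (hq : triNorm q = K) (hr : triNorm r = K) (h₁ : hexShift K b p < hexShift K b q) (h₂ : hexShift K b q < hexShift K b r) :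
    hexShift K r p < hexShift K r q := by
  have r1 := hexShift_range hK hb hp
  have r2 := hexShift_range hK hb hq
  have r3 := hexShift_range hK hb hr
  have r4 := hexShift_range hK hr hp
  have r5 := hexShift_range hK hr hq
  have hpq : hexShift K r p ≠ hexShift K r q := fun e => by
    have := hexShift_injOn hK hp hq e; subst this; exact lt_irrefl _ h₁
  rcases hexShift_rebase hK hb hr hp with e | e <;> rcases hexShift_rebase hK hb hr hq with e' | e' <;> omega

/-! ### Cutting a slit out of a crossing path -/

/-- **A crossing path contains a slit**: a path of `C ⊆ A = {m ≤ |v| ≤ N'}` from `∂Λ_m` to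
`∂Λ_{N'}` (`1 ≤ m`, `m + 2 ≤ N'`) contains the support of a clean crossing path (from its last
visit to `∂Λ_m` to its next visit to `∂Λ_{N'}`), all of whose sites are joined to the end inside `C`. [folklore] -/
theorem exists_isSlit {m N' : ℕ} (hm : 1 ≤ m) (hN : m + 2 ≤ N') {C : Set (Site 2)} (hC : C ⊆ triAnn m N')
    {ζ y : Site 2} (hζ : triNorm ζ = m) (hy : triNorm y = N') (hP : PathIn triGraph C ζ y) :
    ∃ (S : Set (Site 2)) (s t : Site 2), IsSlit m N' S s t ∧ S ⊆ {v | PathIn triGraph C v y} := by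
  -- last visit to `Λ_m`
  obtain ⟨s, b, hsm, hsC, hbm, hsb, hby⟩ :=
    hP.last_exit (C := {v : Site 2 | triNorm v ≤ m}) (show triNorm ζ ≤ (m : ℤ) from hζ.le)
      (show ¬ triNorm y ≤ (m : ℤ) by rw [hy]; omega)
  simp only [Set.mem_setOf_eq, not_le] at hsm hbm
  have hsn : triNorm s = m := le_antisymm hsm (mem_triAnn.1 (hC hsC)).1
  -- first visit to `∂Λ_{N'}` after it
  have hbN : triNorm b < N' := by have := triNorm_le_triNorm_add_one_of_adj hsb; omega
  obtain ⟨a', t, ha', ht, htC, hat, hq⟩ :=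
    hby.exit (R := {v : Site 2 | triNorm v < N'}) hbN (show ¬ triNorm y < (N' : ℤ) by rw [hy]; exact lt_irrefl _)
  simp only [Set.mem_setOf_eq, not_lt] at ha' ht
  have htn : triNorm t = N' := le_antisymm (mem_triAnn.1 (hC htC.1)).2 ht
  obtain ⟨T, hT, hTp, hTt⟩ := hq.exists_support
  have hbT : b ∈ T := hTp.left_mem
  refine ⟨insert s (insert t T), s, t, ⟨hm, hN, hsn, htn, ?_, ?_, ?_, ?_, ?_⟩, ?_⟩
  · exact Set.mem_insert_of_mem _ (Set.mem_insert _ _)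
  · intro v hv
    rcases hv with rfl | rfl | hv
    · exact hC hsC
    · exact hC htC.1
    · exact hC (hT hv).2.1
  · intro v hv
    have hS_s : s ∈ insert s (insert t T) := Set.mem_insert _ _
    have hsub : T ⊆ insert s (insert t T) := fun z hz => Set.mem_insert_of_mem _ (Set.mem_insert_of_mem _ hz)
    have p_sb : PathIn triGraph (insert s (insert t T)) s b := PathIn.of_adj hS_s (hsub hbT) hsb
    rcases hv with rfl | rfl | hv
    · exact PathIn.refl hS_s
    · exact (p_sb.trans (hTp.mono hsub)).tail hat (Set.mem_insert_of_mem _ (Set.mem_insert _ _))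
    · exact p_sb.trans ((hTt v hv).mono hsub)
  · intro v hv hvm
    rcases hv with rfl | rfl | hv
    · rfl
    · omega
    · have := (hT hv).2.2; simp only [Set.mem_setOf_eq] at this; omega
  · intro v hv hvN
    rcases hv with rfl | rfl | hv
    · omega
    · rfl
    · have := (hT hv).1; simp only [Set.mem_setOf_eq] at this; omega
  · -- every site of the slit is joined to `y` inside `C`
    have hby' : PathIn triGraph C b y := hby.mono fun _ hz => hz.1
    intro v hv
    rcases hv with rfl | rfl | hv
    · exact (PathIn.of_adj hsC hby'.left_mem hsb).trans hby'
    · exact (((hTp.mono fun z hz => (hT hz).2.1).tail hat htC.1).symm).trans hby'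
    · exact ((hTt v hv).mono fun z hz => (hT hz).2.1).symm.trans hby'

/-! ### Arms of one colour are not joined: the other two arms and the hole separate them -/

/-- **No path of `B` joins `x` to `x'` across a `Bᶜ`-path through the hole**: if `x, y, x', y'`
lie on `∂Λ_{N'}` in this anticlockwise order (from `x`), `B` consists of sites of norm `≥ m`
(`1 ≤ m ≤ N'`), and there are paths of `Λ_{N'} ∖ B` from `y` to a site `ζ ∈ ∂Λ_m` and from a site
`ζ' ∈ ∂Λ_m` to `y'`, then there is no path of `Λ_{N'} ∩ B` from `x` to `x'` (join `ζ` to `ζ'`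
through the hole `Λ_{m-1} ⊆ Bᶜ` and apply `triBall_not_interleaved_shift`). [cite: BollobasRiordan2006, Ch. 7 Lemma 5 p. 169] -/
theorem not_joined_through_hole {m N' : ℕ} (hm : 1 ≤ m) (hmN : m ≤ N') (B : Set (Site 2))
    (hB : ∀ v ∈ B, (m : ℤ) ≤ triNorm v) {x y x' y' ζ ζ' : Site 2}
    (hx : triNorm x = N') (hy : triNorm y = N') (hx' : triNorm x' = N') (hy' : triNorm y' = N')
    (h₁ : 0 < hexShift N' x y) (h₂ : hexShift N' x y < hexShift N' x x') (h₃ : hexShift N' x x' < hexShift N' x y')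
    (hζ : triNorm ζ = m) (hζ' : triNorm ζ' = m)
    (hQ₁ : PathIn triGraph ((↑(triBall N') : Set (Site 2)) ∩ Bᶜ) y ζ)
    (hQ₂ : PathIn triGraph ((↑(triBall N') : Set (Site 2)) ∩ Bᶜ) ζ' y')
    (hP : PathIn triGraph ((↑(triBall N') : Set (Site 2)) ∩ B) x x') : False := by
  have hN' : 1 ≤ N' := le_trans hm hmN
  -- the hole connector
  obtain ⟨h, hadj, hh⟩ := exists_adj_mem_triBall_sub_one hm hζ
  obtain ⟨h', hadj', hh'⟩ := exists_adj_mem_triBall_sub_one hm hζ'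
  have holeB : ∀ v : Site 2, triNorm v ≤ (m - 1 : ℕ) → v ∈ (↑(triBall N') : Set (Site 2)) ∩ Bᶜ := by
    intro v hv
    refine ⟨Finset.mem_coe.2 (mem_triBall_iff.2 (by push_cast [hm] at hv; omega)), fun hvB => ?_⟩
    have := hB v hvB; push_cast [hm] at hv; omega
  have hole : PathIn triGraph ((↑(triBall N') : Set (Site 2)) ∩ Bᶜ) h h' :=
    (pathIn_triBall hh hh').mono fun v hv => holeB v (mem_triBall_iff.1 (Finset.mem_coe.1 hv))
  have hQ : PathIn triGraph ((↑(triBall N') : Set (Site 2)) ∩ Bᶜ) y y' :=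
    (((hQ₁.tail hadj (holeB h hh)).trans hole).tail hadj'.symm hQ₂.left_mem).trans hQ₂
  exact triBall_not_interleaved_shift hN' B hx hx hy hx' hy' (by rw [hexShift_self]; exact h₁) h₂ h₃ hP hQ

/-! ### The order of four alternating arms on the inner circle -/

section FourArms

variable {m N' : ℕ} {ω : Set (Site 2)} {X₀ X₁ X₂ X₃ : Set (Site 2)} {ζ₀ ζ₁ ζ₂ ζ₃ y₀ y₁ y₂ y₃ : Site 2}

/-- The sites joined to `y` inside `C`. [folklore] -/
def armReach (C : Set (Site 2)) (y : Site 2) : Set (Site 2) := {v | PathIn triGraph C v y}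

/-- `armReach C y ⊆ C`. [folklore] -/
theorem armReach_subset (C : Set (Site 2)) (y : Site 2) : armReach C y ⊆ C := fun _ hv => hv.left_mem

/-- A path of `C` to `y` runs inside `armReach C y`. [folklore] -/
theorem pathIn_armReach {C : Set (Site 2)} {v y : Site 2} (h : PathIn triGraph C v y) :
    PathIn triGraph (armReach C y) v y :=
  (h.symm.to_reach.mono fun _ hz => (show PathIn triGraph C y _ from hz).symm).symm

/-- **One comparison**: for a slit `S` and two arms `Q : q ⇝ q'`, `R : r ⇝ r'` running in sets
`Xq, Xr ⊆ A` off the slit and off one another, `q` is before `r` from `s₁` iff `q'` is before `r'`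
from `t₁`. [cite: BollobasRiordan2006, Ch. 7 Lemma 5 p. 169] -/
theorem IsSlit.lt_iff_of_sets {n N : ℕ} {S : Set (Site 2)} {s₁ t₁ : Site 2} (h : IsSlit n N S s₁ t₁)
    {Xq Xr : Set (Site 2)} (hXq : Xq ⊆ triAnn n N) (hXqS : ∀ v ∈ Xq, v ∉ S)
    (hXr : Xr ⊆ triAnn n N) (hXrS : ∀ v ∈ Xr, v ∉ S) (hXrq : ∀ v ∈ Xr, v ∉ Xq)
    {q q' r r' : Site 2} (hQ : PathIn triGraph Xq q q') (hR : PathIn triGraph Xr r r')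
    (hq : triNorm q = n) (hq' : triNorm q' = N) (hr : triNorm r = n) (hr' : triNorm r' = N) :
    hexShift n s₁ q < hexShift n s₁ r ↔ hexShift N t₁ q' < hexShift N t₁ r' :=
  h.hexShift_lt_iff (fun v hv => ⟨hXq hv, hXqS v hv⟩) hQ
    (hR.mono fun v hv => ⟨⟨hXr hv, hXrS v hv⟩, hXrq v hv⟩) hq hq' hr hr'

/-- **Four alternating arms keep their cyclic order** (the inner-circle order certificate): let
four arms of `A = {m ≤ |v| ≤ N'}` (`1 ≤ m`, `m + 2 ≤ N'`) run inside sets `X₀, X₁, X₂, X₃ ⊆ A`,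
the arms `0, 2` through open sites and the arms `1, 3` through closed sites of `ω`, from
`ζ_a ∈ ∂Λ_m` to `y_a ∈ ∂Λ_{N'}`, where every site of `X_a` on `∂Λ_{N'}` lies in the perimeter
block of side `0, 2, 3, 5` for `a = 0, 1, 2, 3`. Then anticlockwise from `ζ₁`:
`ζ₂ < ζ₃ < ζ₀`. [cite: Nolin2008, §4.4 (arXiv 0711.4948: proof of Thm. 10, internal extremities)] -/
theorem fourArm_chain (hm : 1 ≤ m) (hN : m + 2 ≤ N')
    (hX₀ : X₀ ⊆ triAnn m N') (hX₁ : X₁ ⊆ triAnn m N') (hX₂ : X₂ ⊆ triAnn m N') (hX₃ : X₃ ⊆ triAnn m N')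
    (hw₀ : ∀ v ∈ X₀, triNorm v = N' → 0 ≤ hexPos N' v ∧ hexPos N' v < N')
    (hw₁ : ∀ v ∈ X₁, triNorm v = N' → 2 * (N' : ℤ) ≤ hexPos N' v ∧ hexPos N' v < 3 * N')
    (hw₂ : ∀ v ∈ X₂, triNorm v = N' → 3 * (N' : ℤ) ≤ hexPos N' v ∧ hexPos N' v < 4 * N')
    (hw₃ : ∀ v ∈ X₃, triNorm v = N' → 5 * (N' : ℤ) ≤ hexPos N' v ∧ hexPos N' v < 6 * N')
    (hζ₀ : triNorm ζ₀ = m) (hζ₁ : triNorm ζ₁ = m) (hζ₂ : triNorm ζ₂ = m) (hζ₃ : triNorm ζ₃ = m)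
    (hy₀ : triNorm y₀ = N') (hy₁ : triNorm y₁ = N') (hy₂ : triNorm y₂ = N') (hy₃ : triNorm y₃ = N')
    (hP₀ : PathIn triGraph (X₀ ∩ ω) ζ₀ y₀) (hP₁ : PathIn triGraph (X₁ ∩ ωᶜ) ζ₁ y₁)
    (hP₂ : PathIn triGraph (X₂ ∩ ω) ζ₂ y₂) (hP₃ : PathIn triGraph (X₃ ∩ ωᶜ) ζ₃ y₃) :
    hexShift m ζ₁ ζ₂ < hexShift m ζ₁ ζ₃ ∧ hexShift m ζ₁ ζ₃ < hexShift m ζ₁ ζ₀ := by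
  have hmN : m ≤ N' := by omega
  have hN' : 1 ≤ N' := by omega
  -- the reach sets of the four arms
  set R₀ := armReach (X₀ ∩ ω) y₀ with hR₀
  set R₁ := armReach (X₁ ∩ ωᶜ) y₁ with hR₁
  set R₂ := armReach (X₂ ∩ ω) y₂ with hR₂
  set R₃ := armReach (X₃ ∩ ωᶜ) y₃ with hR₃
  have hQ₀ : PathIn triGraph R₀ ζ₀ y₀ := pathIn_armReach hP₀
  have hQ₁ : PathIn triGraph R₁ ζ₁ y₁ := pathIn_armReach hP₁
  have hQ₂ : PathIn triGraph R₂ ζ₂ y₂ := pathIn_armReach hP₂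
  have hQ₃ : PathIn triGraph R₃ ζ₃ y₃ := pathIn_armReach hP₃
  have hR₀A : R₀ ⊆ triAnn m N' := fun v hv => hX₀ (armReach_subset _ _ hv).1
  have hR₁A : R₁ ⊆ triAnn m N' := fun v hv => hX₁ (armReach_subset _ _ hv).1
  have hR₂A : R₂ ⊆ triAnn m N' := fun v hv => hX₂ (armReach_subset _ _ hv).1
  have hR₃A : R₃ ⊆ triAnn m N' := fun v hv => hX₃ (armReach_subset _ _ hv).1
  -- colours separate arms of different colours
  have d01 : ∀ v ∈ R₀, v ∉ R₁ := fun v hv hv' => (armReach_subset _ _ hv').2 (armReach_subset _ _ hv).2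
  have d03 : ∀ v ∈ R₀, v ∉ R₃ := fun v hv hv' => (armReach_subset _ _ hv').2 (armReach_subset _ _ hv).2
  have d21 : ∀ v ∈ R₂, v ∉ R₁ := fun v hv hv' => (armReach_subset _ _ hv').2 (armReach_subset _ _ hv).2
  have d23 : ∀ v ∈ R₂, v ∉ R₃ := fun v hv hv' => (armReach_subset _ _ hv').2 (armReach_subset _ _ hv).2
  -- the outer ends, in perimeter coordinate
  have py₀ := hw₀ y₀ hP₀.right_mem.1 hy₀
  have py₁ := hw₁ y₁ hP₁.right_mem.1 hy₁
  have py₂ := hw₂ y₂ hP₂.right_mem.1 hy₂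
  have py₃ := hw₃ y₃ hP₃.right_mem.1 hy₃
  -- the ball versions of the arms
  set B := {v : Site 2 | (m : ℤ) ≤ triNorm v ∧ v ∈ ω} with hB
  set B' := {v : Site 2 | (m : ℤ) ≤ triNorm v ∧ v ∉ ω} with hB'
  have toBall : ∀ {C : Set (Site 2)} {D : Set (Site 2)}, C ⊆ triAnn m N' → (∀ v ∈ C, v ∈ D) → ∀ {a b : Site 2},
      PathIn triGraph C a b → PathIn triGraph ((↑(triBall N') : Set (Site 2)) ∩ D) a b := by
    intro C D hC hD a b hp
    exact hp.mono fun v hv => ⟨Finset.mem_coe.2 (mem_triBall_iff.2 (mem_triAnn.1 (hC hv)).2), hD v hv⟩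
  have sub₀ : ∀ v ∈ X₀ ∩ ω, v ∈ B := fun v hv => ⟨(mem_triAnn.1 (hX₀ hv.1)).1, hv.2⟩
  have sub₂ : ∀ v ∈ X₂ ∩ ω, v ∈ B := fun v hv => ⟨(mem_triAnn.1 (hX₂ hv.1)).1, hv.2⟩
  have sub₁ : ∀ v ∈ X₁ ∩ ωᶜ, v ∈ B' := fun v hv => ⟨(mem_triAnn.1 (hX₁ hv.1)).1, hv.2⟩
  have sub₃ : ∀ v ∈ X₃ ∩ ωᶜ, v ∈ B' := fun v hv => ⟨(mem_triAnn.1 (hX₃ hv.1)).1, hv.2⟩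
  have sub₁c : ∀ v ∈ X₁ ∩ ωᶜ, v ∈ Bᶜ := fun v hv hvB => hv.2 hvB.2
  have sub₃c : ∀ v ∈ X₃ ∩ ωᶜ, v ∈ Bᶜ := fun v hv hvB => hv.2 hvB.2
  have sub₀c : ∀ v ∈ X₀ ∩ ω, v ∈ B'ᶜ := fun v hv hvB => hvB.2 hv.2
  have sub₂c : ∀ v ∈ X₂ ∩ ω, v ∈ B'ᶜ := fun v hv hvB => hvB.2 hv.2
  have hX₀ω : X₀ ∩ ω ⊆ triAnn m N' := fun v hv => hX₀ hv.1
  have hX₁ω : X₁ ∩ ωᶜ ⊆ triAnn m N' := fun v hv => hX₁ hv.1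
  have hX₂ω : X₂ ∩ ω ⊆ triAnn m N' := fun v hv => hX₂ hv.1
  have hX₃ω : X₃ ∩ ωᶜ ⊆ triAnn m N' := fun v hv => hX₃ hv.1
  have rx₀ := hexPos_range hN' hy₀
  -- (D1) the open arms are not joined: `R₀ ∩ R₂ = ∅`
  have d02 : ∀ v ∈ R₀, v ∉ R₂ := by
    intro v hv hv'
    have hP : PathIn triGraph ((↑(triBall N') : Set (Site 2)) ∩ B) y₀ y₂ :=
      (toBall hX₀ω sub₀ (show PathIn triGraph (X₀ ∩ ω) v y₀ from hv)).symm.trans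
        (toBall hX₂ω sub₂ (show PathIn triGraph (X₂ ∩ ω) v y₂ from hv'))
    refine not_joined_through_hole hm hmN B (fun v hv => hv.1) hy₀ hy₁ hy₂ hy₃ ?_ ?_ ?_ hζ₁ hζ₃
      (toBall hX₁ω sub₁c hP₁).symm (toBall hX₃ω sub₃c hP₃) hP
    all_goals unfold hexShift; split_ifs <;> omega
  -- (D2) the closed arms are not joined: `R₁ ∩ R₃ = ∅`
  have d13 : ∀ v ∈ R₁, v ∉ R₃ := by
    intro v hv hv'
    have hP : PathIn triGraph ((↑(triBall N') : Set (Site 2)) ∩ B') y₁ y₃ :=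
      (toBall hX₁ω sub₁ (show PathIn triGraph (X₁ ∩ ωᶜ) v y₁ from hv)).symm.trans
        (toBall hX₃ω sub₃ (show PathIn triGraph (X₃ ∩ ωᶜ) v y₃ from hv'))
    have rx₁ := hexPos_range hN' hy₁
    refine not_joined_through_hole hm hmN B' (fun v hv => hv.1) hy₁ hy₂ hy₃ hy₀ ?_ ?_ ?_ hζ₂ hζ₀
      (toBall hX₂ω sub₂c hP₂).symm (toBall hX₀ω sub₀c hP₀) hP
    all_goals unfold hexShift; split_ifs <;> omega
  have d20 : ∀ v ∈ R₂, v ∉ R₀ := fun v hv hv' => d02 v hv' hv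
  have d31 : ∀ v ∈ R₃, v ∉ R₁ := fun v hv hv' => d13 v hv' hv
  have d10 : ∀ v ∈ R₁, v ∉ R₀ := fun v hv hv' => d01 v hv' hv
  have d30 : ∀ v ∈ R₃, v ∉ R₀ := fun v hv hv' => d03 v hv' hv
  have d12 : ∀ v ∈ R₁, v ∉ R₂ := fun v hv hv' => d21 v hv' hv
  have d32 : ∀ v ∈ R₃, v ∉ R₂ := fun v hv hv' => d23 v hv' hv
  -- slit out of arm 0: from its inner end, `ζ₁ < ζ₂ < ζ₃`
  obtain ⟨S, s, t, hS, hSR⟩ := exists_isSlit hm hN hX₀ω hζ₀ hy₀ hP₀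
  have hSR₀ : S ⊆ R₀ := hSR
  have pt := hw₀ t (armReach_subset _ _ (hSR₀ hS.mem_t)).1 hS.norm_t
  have offS₁ : ∀ v ∈ R₁, v ∉ S := fun v hv hvS => d10 v hv (hSR₀ hvS)
  have offS₂ : ∀ v ∈ R₂, v ∉ S := fun v hv hvS => d20 v hv (hSR₀ hvS)
  have offS₃ : ∀ v ∈ R₃, v ∉ S := fun v hv hvS => d30 v hv (hSR₀ hvS)
  have a12 : hexShift m s ζ₁ < hexShift m s ζ₂ := by
    rw [hS.lt_iff_of_sets hR₁A offS₁ hR₂A offS₂ d21 hQ₁ hQ₂ hζ₁ hy₁ hζ₂ hy₂]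
    unfold hexShift; split_ifs <;> omega
  have a23 : hexShift m s ζ₂ < hexShift m s ζ₃ := by
    rw [hS.lt_iff_of_sets hR₂A offS₂ hR₃A offS₃ d32 hQ₂ hQ₃ hζ₂ hy₂ hζ₃ hy₃]
    unfold hexShift; split_ifs <;> omega
  -- slit out of arm 2: from its inner end, `ζ₃ < ζ₀ < ζ₁`
  obtain ⟨S', s', t', hS', hSR'⟩ := exists_isSlit hm hN hX₂ω hζ₂ hy₂ hP₂
  have hSR₂ : S' ⊆ R₂ := hSR'
  have pt' := hw₂ t' (armReach_subset _ _ (hSR₂ hS'.mem_t)).1 hS'.norm_t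
  have offS'₀ : ∀ v ∈ R₀, v ∉ S' := fun v hv hvS => d02 v hv (hSR₂ hvS)
  have offS'₁ : ∀ v ∈ R₁, v ∉ S' := fun v hv hvS => d12 v hv (hSR₂ hvS)
  have offS'₃ : ∀ v ∈ R₃, v ∉ S' := fun v hv hvS => d32 v hv (hSR₂ hvS)
  have b30 : hexShift m s' ζ₃ < hexShift m s' ζ₀ := by
    rw [hS'.lt_iff_of_sets hR₃A offS'₃ hR₀A offS'₀ d03 hQ₃ hQ₀ hζ₃ hy₃ hζ₀ hy₀]
    unfold hexShift; split_ifs <;> omega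
  have b01 : hexShift m s' ζ₀ < hexShift m s' ζ₁ := by
    rw [hS'.lt_iff_of_sets hR₀A offS'₀ hR₁A offS'₁ d10 hQ₀ hQ₁ hζ₀ hy₀ hζ₁ hy₁]
    unfold hexShift; split_ifs <;> omega
  -- rotate both chains to the base `ζ₁`
  exact ⟨hexShift_rotate₁ hm hS.norm_s hζ₁ hζ₂ hζ₃ a12 a23, hexShift_rotate₃ hm hS'.norm_s hζ₃ hζ₀ hζ₁ b30 b01⟩

end FourArms

end Literature.Probability.Percolation
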